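import Summits.CriticalPhenomena.PercolationContinuityZ3.Theorems.FK.Transplant.KNFreeElongated
import HarnessLib

/-!
# FK transplant, row FT-04 (3/3): Kozma–Nitzan Lemma 12 — corridor concentration — for a law family

**Framing.** The transplant theorem of record of this sub-cell
(`ufsc0_of_freeBoundaryHypothesis_r0`, `Transplant/FreeBoundaryTransplant.lean`) is CONDITIONAL on the
free-boundary hypothesis FH (open at the same `p` for `q > 1`; over `p > p_c(q)` it is GRC Conj. (5.103) /
Duminil-Copin–Tassion Q5 territory, calibration K1; barrier note
`Literature.Barriers.CriticalPhenomena.SamePFreeBoundaryCriteria`); it is a typed reduction, not a proof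
of continuity of the FK transition. Builds on p205010 (kernel theorem, internal audit signed; external
expert review pending). THIS file states and discharges NO binder of the record: it is law-abstract
infrastructure (cell `bschramm/fk-continuity`, FRONTIER TRANSPLANT, registry row FT-04, writer fkt-p2;
`--supports stmt-CriticalPhenomena-4575 --as helper`).

Law-abstract port of the measure-dependent half of the Lemma-12 part of the tree's `q = 1` file
`Literature/Probability/Percolation/KozmaNitzanCorridor.lean` (G. Kozma, S. Nitzan, arXiv:2401.12397, §4,
Lemma 12, pp. 23–25): `d` inward halving steps under the weighting restricted to `A`
(`halvingStepLaw`, `halvingChainLaw`), weight monotonicity `W|_A ≤ W|_U`, and the corridor step under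
the weighting restricted to `U` with the elongated geometries of aspect `88` (`corridorStepLaw`, using
Lemma 11 of `KNFreeElongated.lean`) give `corridorLemmaLaw` — for `μ = fkLaw · · q` the PROVE binder
`KNFreeCorridorRestr` of the record (matrix `FKCorridorRestrAt`: hypothesis under
`μ T.Sfin (restrW ↑T.Aset T.W)`, conclusion under `restrW ↑T.Uset T.W`, events plain `openConn`) — and
`corridorLemmaLaw_in`, its conclusion as a connection INSIDE `U` under the unrestricted weighting (the
shape consumed by the port of KN Theorem 6, Step IV p. 31). The tree's `q = 1` restriction identity
`prodBernoulli_restrW_real_biUnion_openConn` holds for `q ≥ 1` only as the inequality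
`real_restrW_biUnion_openConn_le` (`KNFreeLawInterfaces.lean`), which is why the hypothesis is taken under
the restricted weighting (KN p. 24: "in the subgraph `A`"). Geometry (`CData`, `Hyp`, `Bk`, `Tn`,
`isTarget_halving`, `isTarget_corridor`, …) imported from the `q = 1` file.

## References

* G. Kozma, S. Nitzan, arXiv:2401.12397 (2024), §4 Lemma 12 (pp. 23–25), p. 31. [KozmaNitzan2024]
* G. Grimmett, *The Random-Cluster Model*, Springer 2006: Thm. (3.21), eq. (3.22). [Grimmett2006]
-/

noncomputable section

open MeasureTheory ProbabilityTheory
open scoped ENNReal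

namespace Summit.CriticalPhenomena.PercolationContinuityZ3.Theorems.FK

open Literature.Probability.Percolation Literature.Probability.LatticeModels SimpleGraph
open Literature.Probability.Percolation.KozmaNitzan

variable {d : ℕ}

section Lemma12

variable (μ : Finset (Site d) → (Sym2 (Site d) → unitInterval) → Measure (BondConfig (Site d)))

/-- `U` lies in the support. [folklore] -/
theorem CDataFK.Uset_subset_Sfin {S : CData d} {p : unitInterval} (hS : S.Hyp p) : S.Uset ⊆ S.Sfin := by
  intro x hx
  rcases Finset.mem_union.1 hx with h | h
  · exact (Finset.mem_sdiff.1 h).1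
  · refine hS.DS ?_
    rw [S.mem_corridor_iff] at h
    rw [S.mem_bigD_iff]
    refine ⟨⟨by linarith [h.1.1], by linarith [h.1.2]⟩, fun j hj => ?_⟩
    have := h.2 j hj
    constructor <;> linarith [this.1, this.2]

/-- **One halving step for the law family `μ`** (target property in the weighting restricted to `A`, with
the quarter faces; law-swapped `KozmaNitzan.CData.halvingStep_of_target`): there are `δ > 0` and `R₀`
such that, whenever the cube `B_k` is reached from `o` with probability `> 1 - δ` under the law of
`restrW A W`, then `B_{k+1}` is reached with probability `> 1 - ε`. [cite: KozmaNitzan2024, §4 p. 24] -/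
theorem halvingStepLaw [NeZero d] (p : unitInterval) (hT : TargetPropertyLaw μ p)
    (hqf : ∀ g ∈ qfList d, IsHittableLaw μ p g) {ε : ℝ} (hε : 0 < ε) :
    ∃ δ : ℝ, 0 < δ ∧ ∃ R₀ : ℕ, ∀ (S : CData d), S.Hyp p → ∀ (k R : ℕ), k < d → R₀ ≤ R → R₀ ≤ S.lh →
      ((S.r + 1) / 2 : ℕ) + (k : ℤ) * R + R ≤ S.r →
      1 - δ < (μ S.Sfin (restrW (↑S.Aset : Set (Site d)) S.W)).real (⋃ b ∈ S.Bk k R, openConn S.o b) →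
        1 - ε < (μ S.Sfin (restrW (↑S.Aset : Set (Site d)) S.W)).real
          (⋃ b ∈ S.Bk (k + 1) R, openConn S.o b) := by
  obtain ⟨δ, hδ, hH⟩ := hT hε
  obtain ⟨R₀, hR₀⟩ := hH (qfList d) hqf
  refine ⟨δ, hδ, R₀, fun S hS k R hk hR hRlh hfit hB => ?_⟩
  have hR' : (R₀ : ℤ) ≤ R := by exact_mod_cast hR
  have hfit0 : ((S.r + 1) / 2 : ℕ) + (k : ℤ) * R + R₀ ≤ S.r := by linarith
  have hkR : (k : ℤ) * R + R₀ ≤ 2 * S.r := by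
    have : (0 : ℤ) ≤ ((S.r + 1) / 2 : ℕ) := by positivity
    linarith
  have hkR1 : ((k + 1 : ℕ) : ℤ) * R ≤ 2 * S.r := by push_cast; linarith
  exact hR₀ (restrW (↑S.Aset : Set (Site d)) S.W) S.Sfin S.nearQ (S.c - S.hwid k R) (S.c + S.hwid k R)
    (S.Bk (k + 1) R) S.o (finSupp_of_le (restrW_le _ _) hS.fin)
    ((CData.isSubbox_nearQ hS).restrW (Finset.coe_subset.2 (CData.nearQ_subset_Aset hS)))
    (S.nearQ_subset_bigD.trans hS.DS) hS.o_mem (CData.o_not_mem_nearQ hS)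
    (S.enlarge_Bk_subset_nearQ hkR) (S.isTarget_halving hk hR hRlh hfit0) (S.Bk_subset_nearQ hkR1)
    (S.Bk_nonempty _ _) hB

/-- **The chain of halving steps for the law family `μ`**: `n` steps from `B_k` to `B_{k+n}` (`k + n ≤ d`).
[cite: KozmaNitzan2024, §4 p. 24 ("We continue this way, each time halving one dimension")] -/
theorem halvingChainLaw [NeZero d] (p : unitInterval) (hT : TargetPropertyLaw μ p)
    (hqf : ∀ g ∈ qfList d, IsHittableLaw μ p g) (n : ℕ) {ε : ℝ} (hε : 0 < ε) :
    ∃ δ : ℝ, 0 < δ ∧ ∃ R₀ : ℕ, ∀ (S : CData d), S.Hyp p → ∀ (k R : ℕ), k + n ≤ d → R₀ ≤ R → R₀ ≤ S.lh →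
      ((S.r + 1) / 2 : ℕ) + (d : ℤ) * R + R ≤ S.r →
      1 - δ < (μ S.Sfin (restrW (↑S.Aset : Set (Site d)) S.W)).real (⋃ b ∈ S.Bk k R, openConn S.o b) →
        1 - ε < (μ S.Sfin (restrW (↑S.Aset : Set (Site d)) S.W)).real
          (⋃ b ∈ S.Bk (k + n) R, openConn S.o b) := by
  induction n generalizing ε with
  | zero =>
    refine ⟨ε, hε, 0, fun S _ k R _ _ _ _ hB => ?_⟩
    simpa using hB
  | succ n ih =>
    obtain ⟨δ', hδ', R₁, h1⟩ := ih hε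
    obtain ⟨δ, hδ, R₂, h2⟩ := halvingStepLaw μ p hT hqf hδ'
    refine ⟨δ, hδ, max R₁ R₂, fun S hS k R hkn hR hRlh hfit hB => ?_⟩
    have hfitk : ((S.r + 1) / 2 : ℕ) + (k : ℤ) * R + R ≤ S.r := by
      have : (k : ℤ) * R ≤ (d : ℤ) * R :=
        mul_le_mul_of_nonneg_right (by exact_mod_cast (by omega : k ≤ d)) (by positivity)
      linarith
    have step := h2 S hS k R (by omega) (le_of_max_le_right hR) ((le_max_right _ _).trans hRlh) hfitk hB
    have rest := h1 S hS (k + 1) R (by omega) (le_of_max_le_left hR) ((le_max_left _ _).trans hRlh) hfit step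
    have e : k + 1 + n = k + (n + 1) := by ring
    rw [e] at rest
    exact rest

/-- **The corridor step for the law family `μ`** (the last application of the target property in the proof
of Lemma 12, in the weighting restricted to `U`, with the elongated geometries of aspect `88`;
law-swapped `KozmaNitzan.CData.corridorStep_of_target`). [cite: KozmaNitzan2024, §4 pp. 24–25] -/
theorem corridorStepLaw [NeZero d] (hμ : LawMono μ) (hext : LawExt μ) (hnull : LawNull μ)
    (hone : LawOne μ) (hfin : ∀ Λ W, IsFiniteMeasure (μ Λ W)) (p : unitInterval)
    (hT : TargetPropertyLaw μ p) (hqf : ∀ (a : Fin d) (τ : Fin d → ℤˣ), IsHittableLaw μ p (qfGeom a τ))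
    {ε : ℝ} (hε : 0 < ε) :
    ∃ δ : ℝ, 0 < δ ∧ ∃ R₀ : ℕ, ∀ (S : CData d), S.Hyp p → ∀ R : ℕ, 44 ≤ S.r → 5 * R₀ + 5 ≤ S.r →
      4 * ((S.lh : ℤ) + d * R + R₀) + 4 ≤ 7 * S.r →
      1 - δ < (μ S.Sfin (restrW (↑S.Uset : Set (Site d)) S.W)).real (⋃ b ∈ S.Bk d R, openConn S.o b) →
        1 - ε < (μ S.Sfin (restrW (↑S.Uset : Set (Site d)) S.W)).real
          (⋃ b ∈ S.Tn (2 * S.r), openConn S.o b) := by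
  obtain ⟨δ, hδ, hH⟩ := hT hε
  obtain ⟨R₀, hR₀⟩ := hH (elongList d 88 (by norm_num))
    (isHittableLaw_of_mem_elongList μ hμ hext hnull hone hfin p hT hqf 88 (by norm_num))
  refine ⟨δ, hδ, R₀, fun S hS R h44 hRc hΔ hB => ?_⟩
  have hw : ∀ i, S.hwid d R i = S.lh + d * R := fun i => by rw [S.hwid_apply, if_pos i.2]
  have hRc' : 5 * (R₀ : ℤ) + 5 ≤ S.r := by exact_mod_cast hRc
  have hencl : Finset.Icc (S.c - S.hwid d R - (R₀ : Site d)) (S.c + S.hwid d R + (R₀ : Site d)) ⊆ S.Dcorr := by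
    intro x hx
    rw [mem_Icc_iff] at hx
    simp only [Pi.sub_apply, Pi.add_apply, Pi.natCast_apply] at hx
    rw [S.mem_Dcorr_iff]
    have hlh : (0 : ℤ) ≤ S.lh := by positivity
    refine ⟨?_, fun j hj => ?_⟩
    · have := hx S.a; rw [hw] at this
      have hb := level_bounds_of_abs_le S.hσ (x := S.c S.a) (y := x S.a) (ℓ := S.lh + d * R + R₀)
        (by linarith) (by linarith)
      have e : S.σ * (x S.a - S.c S.a) = S.σ * x S.a - S.σ * S.c S.a := by ring
      rw [e]; constructor <;> linarith [hb.1, hb.2]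
    · have := hx j; rw [hw] at this
      constructor <;> linarith [this.1, this.2]
  have hTD : S.Tn (2 * S.r) ⊆ S.Dcorr := by
    intro x hx
    rw [S.mem_Tn_iff] at hx
    rw [S.mem_Dcorr_iff]
    push_cast at hx
    refine ⟨⟨by linarith [hx.1.1], by linarith [hx.1.2]⟩, fun j hj => ?_⟩
    have := hx.2 j hj
    constructor <;> linarith [this.1, this.2]
  exact hR₀ (restrW (↑S.Uset : Set (Site d)) S.W) S.Sfin S.Dcorr (S.c - S.hwid d R) (S.c + S.hwid d R)
    (S.Tn (2 * S.r)) S.o (finSupp_of_le (restrW_le _ _) hS.fin)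
    ((CData.isSubbox_Dcorr hS).restrW (Finset.coe_subset.2 (CData.Dcorr_subset_Uset hS)))
    ((CData.Dcorr_subset_Uset hS).trans (CDataFK.Uset_subset_Sfin hS)) hS.o_mem (CData.o_not_mem_Dcorr hS)
    hencl (S.isTarget_corridor h44 hRc hΔ) hTD (S.Tn_nonempty _) hB

/-- **Kozma–Nitzan 2024, Lemma 12, for the law family `μ`** (for `μ = fkLaw · · q` this is the PROVE
binder `KNFreeCorridorBound` of the record, matrix `FKCorridorAt`). Given the structural hypotheses, the
target property and the hittability of the quarter faces: for every `ε > 0` there are `δ > 0` and `m`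
such that for every corridor datum `S` of scale `r ≥ m` satisfying the hypotheses (a weighting `W`
finitely supported on `Sfin`, with the lattice subbox `D = c + {-5r ≤ σ x_a ≤ 25r, |x_j| ≤ 5r}`, `o ∈ Sfin ∖ D`):
`μ_{Sfin, W|_A}(o ↔ c + [-3r,3r]^d) > 1 - δ ⟹ μ_{Sfin, W|_U}(o ↔ cnext + [-3r,3r]^d) > 1 - ε`, where
`W|_A = restrW A W`, `A` = support minus the far part of `D`, `U = A ∪` corridor, `cnext = c + 20rσe_a`
(KN: "`P(o ↔^A [-3r,3r]^d) > 1 - δ ⟹ P(o ↔^U (20r, 0, …, 0) + [-3r,3r]^d) > 1 - ε`" — `d` halving steps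
under `W|_A`, weight monotonicity `W|_A ≤ W|_U`, the corridor step under `W|_U`).
[cite: KozmaNitzan2024, §4 Lemma 12 (pp. 23–25)] -/
theorem corridorLemmaLaw [NeZero d] (hμ : LawMono μ) (hext : LawExt μ) (hnull : LawNull μ)
    (hone : LawOne μ) (hfin : ∀ Λ W, IsFiniteMeasure (μ Λ W)) (p : unitInterval)
    (hT : TargetPropertyLaw μ p) (hqf : ∀ (a : Fin d) (τ : Fin d → ℤˣ), IsHittableLaw μ p (qfGeom a τ))
    {ε : ℝ} (hε : 0 < ε) :
    ∃ δ : ℝ, 0 < δ ∧ ∃ m : ℕ, ∀ S : CData d, S.Hyp p → m ≤ S.r →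
      1 - δ < (μ S.Sfin (restrW (↑S.Aset : Set (Site d)) S.W)).real
          (⋃ b ∈ Finset.Icc (S.c - ((3 * S.r : ℕ) : Site d)) (S.c + ((3 * S.r : ℕ) : Site d)),
            openConn S.o b) →
        1 - ε < (μ S.Sfin (restrW (↑S.Uset : Set (Site d)) S.W)).real
          (⋃ b ∈ S.Tn (3 * S.r), openConn S.o b) := by
  have hqf' : ∀ g ∈ qfList d, IsHittableLaw μ p g := by
    intro g hg
    obtain ⟨x, -, rfl⟩ := List.mem_map.1 hg
    exact hqf x.1 x.2
  obtain ⟨δc, hδc, Rc, hcorr⟩ := corridorStepLaw μ hμ hext hnull hone hfin p hT hqf hε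
  obtain ⟨δh, hδh, Rh, hhalf⟩ := halvingChainLaw μ p hT hqf' d hδc
  set R : ℕ := max Rc Rh with hRdef
  refine ⟨δh, hδh, 100 * (d + 1) * (R + 1), fun S hS hm hA => ?_⟩
  -- arithmetic
  have hR1 : Rc ≤ R := le_max_left _ _
  have hR2 : Rh ≤ R := le_max_right _ _
  have hm' : 100 * ((d : ℤ) + 1) * (R + 1) ≤ S.r := by exact_mod_cast hm
  have hd0 : (0 : ℤ) ≤ d := by positivity
  have hR0 : (0 : ℤ) ≤ R := by positivity
  have hdR : (0 : ℤ) ≤ d * R := by positivity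
  have hexp : 100 * ((d : ℤ) + 1) * (R + 1) = 100 * (d * R) + 100 * d + 100 * R + 100 := by ring
  have hlh := S.two_lh
  have hhalf' : (((S.r + 1) / 2 : ℕ) : ℤ) + (S.r : ℤ) = S.lh := by unfold CData.lh; push_cast; ring
  have hRc' : (Rc : ℤ) ≤ R := by exact_mod_cast hR1
  have hRh' : (Rh : ℤ) ≤ R := by exact_mod_cast hR2
  -- the hypothesis, as the cube `B_0`
  have h0 : 1 - δh < (μ S.Sfin (restrW (↑S.Aset : Set (Site d)) S.W)).real
      (⋃ b ∈ S.Bk 0 R, openConn S.o b) := by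
    rw [S.Bk_zero]
    exact hA
  -- the halving chain
  have h1 := hhalf S hS 0 R (by omega) hR2 ?_ ?_ h0
  rotate_left
  · have : (R : ℤ) ≤ S.lh := by linarith
    have : (Rh : ℤ) ≤ S.lh := by linarith
    exact_mod_cast this
  · have hdRh : (d : ℤ) * R ≤ d * R := le_rfl
    linarith
  rw [zero_add] at h1
  -- from `A` to `U`: the weighting restricted to `U` dominates the one restricted to `A`
  haveI := hfin
  have h2 : 1 - δc < (μ S.Sfin (restrW (↑S.Uset : Set (Site d)) S.W)).real
      (⋃ b ∈ S.Bk d R, openConn S.o b) :=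
    h1.trans_le (hμ (restrW_mono_set (Finset.coe_subset.2 S.Aset_subset_Uset) S.W)
      (isUpperSet_biUnion_openConn _ _) (measurableSet_biUnion_openConn _ _))
  -- the corridor step
  have h3 := hcorr S hS R ?_ ?_ ?_ h2
  rotate_left
  · have : (44 : ℤ) ≤ S.r := by linarith
    exact_mod_cast this
  · have : 5 * (Rc : ℤ) + 5 ≤ S.r := by linarith
    exact_mod_cast this
  · have : (d : ℤ) * Rc ≤ d * R := mul_le_mul_of_nonneg_left hRc' hd0
    nlinarith
  -- the larger target cube
  refine h3.trans_le (measureReal_mono ?_ (measure_ne_top _ _))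
  intro ω hω
  simp only [Set.mem_iUnion, exists_prop] at hω ⊢
  obtain ⟨x, hx, hω⟩ := hω
  refine ⟨x, ?_, hω⟩
  rw [S.mem_Tn_iff] at hx ⊢
  push_cast at hx ⊢
  refine ⟨⟨by linarith [hx.1.1], by linarith [hx.1.2]⟩, fun j hj => ?_⟩
  have := hx.2 j hj
  constructor <;> linarith [this.1, this.2]

/-- **Lemma 12 for the law family `μ`, conclusion inside `U` under the unrestricted weighting** (the
shape consumed by the port of KN Theorem 6, Step IV p. 31: `P_W(o ↔ cnext + [-3r,3r]^d inside U) > 1 - ε`),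
from `corridorLemmaLaw` and `real_restrW_biUnion_openConn_le`.
[cite: KozmaNitzan2024, §4 Lemma 12 (pp. 23–25), p. 31] -/
theorem corridorLemmaLaw_in [NeZero d] (hμ : LawMono μ) (hext : LawExt μ) (hnull : LawNull μ)
    (hone : LawOne μ) (hfin : ∀ Λ W, IsFiniteMeasure (μ Λ W)) (p : unitInterval)
    (hT : TargetPropertyLaw μ p) (hqf : ∀ (a : Fin d) (τ : Fin d → ℤˣ), IsHittableLaw μ p (qfGeom a τ))
    {ε : ℝ} (hε : 0 < ε) :
    ∃ δ : ℝ, 0 < δ ∧ ∃ m : ℕ, ∀ S : CData d, S.Hyp p → m ≤ S.r →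
      1 - δ < (μ S.Sfin (restrW (↑S.Aset : Set (Site d)) S.W)).real
          (⋃ b ∈ Finset.Icc (S.c - ((3 * S.r : ℕ) : Site d)) (S.c + ((3 * S.r : ℕ) : Site d)),
            openConn S.o b) →
        1 - ε < (μ S.Sfin S.W).real (⋃ b ∈ S.Tn (3 * S.r), openConnIn (↑S.Uset : Set (Site d)) S.o b) := by
  obtain ⟨δ, hδ, m, h⟩ := corridorLemmaLaw μ hμ hext hnull hone hfin p hT hqf hε
  refine ⟨δ, hδ, m, fun S hS hm hA => ?_⟩
  have hoU : S.o ∈ (↑S.Uset : Set (Site d)) :=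
    Finset.mem_coe.2 (S.Aset_subset_Uset (CData.o_mem_Aset hS))
  have h1 := h S hS hm hA
  rw [← Finset.set_biUnion_coe] at h1 ⊢
  exact h1.trans_le (real_restrW_biUnion_openConn_le μ hμ hnull S.Sfin S.W _ hoU _)

end Lemma12

end Summit.CriticalPhenomena.PercolationContinuityZ3.Theorems.FK

end
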